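import Mathlib
import Summits.Ventures.Crystal3D.Theorems.StickyWulffConstantTextureLiminfTentComplex
import HarnessLib

/-!
# The tent certificate for fcc grains — per-cell costs and the local broken-bond currency (eng g8)

Route `StickyWulffConstant` (`Summits/Ventures/Crystal3D`, cell `crystal3d-full`), support toward the crux
`TextureLiminf` (stmt-Ventures-19483), FREE half (tent certificate, TexShadow v6.1).
* `cost_labelUp_le`, `cost_labelDn_le`, `cost_labelCorner_le` — for the affine piece `⟪g, ·⟫ + b` of the
  tent on a cell: `phiFcc g · |cell| ≤ cost/24` with the integer costs of `…TentTables.lean`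
  (`2·eTetUp`, `2·eTetDn`, `corner`) — via the vertex values of the tent and the bridge lemmas
  `phiFcc_grad_tetUp/Dn/corner`, `volume_cellOf_*_le`;
* `sum_corner_eq_octCost24` — the eight corner costs of an octahedron add up to `octCost24`;
* `dist_le_sqrt2_of_mem_closedChamber` (two points of one closed chamber), `dist_octV_le_sqrt2` (an
  octahedron vertex and a point of one of its corners) — hence every bond covered by a cell whose closure
  meets `U` has its occupied end within `√2` of `U`: `card_coveredBonds_le_brokenNear`.
WHAT THIS IS NOT: the certificate (next file); F-C1 not moved.
-/

noncomputable section

namespace Summit.Ventures.Crystal3D.TentCertificate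

open Finset Summit.Ventures.Crystal3D MeasureTheory
open Literature.Geometry.DiscreteGeometry (intVec intVec_apply)
open Literature.MathematicalPhysics.StatisticalMechanics (phiFcc phiFcc_nonneg)
open scoped RealInnerProductSpace

/-! ## Per-cell cost bounds -/

/-- Vertex values of the tent in `indR` form (up-tetrahedron). -/
theorem tent_site_patUp (X : Finset Site) (p : Site) (j : Fin 4) :
    tent X (site (p + tetUpV j)) = indR (patUp X p j) := by
  rw [site_eq, tent_site]; simp [indR, patUp]

/-- Vertex values of the tent in `indR` form (down-tetrahedron). -/
theorem tent_site_patDn (X : Finset Site) (p : Site) (j : Fin 4) :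
    tent X (site (p + tetDnV j)) = indR (patDn X p j) := by
  rw [site_eq, tent_site]; simp [indR, patDn]

/-- Vertex values of the tent in `indR` form (octahedron vertices). -/
theorem tent_site_patO (X : Finset Site) (p : Site) (i : Fin 6) :
    tent X (site (p + octV i)) = indR (patO X p i) := by
  rw [site_eq, tent_site]; simp [indR, patO]

/-- An octahedron with no occupied vertex has centre value `0`. -/
theorem twoAlpha_patO_eq_zero_of_not_mem_idx {X : Finset Site} {p : Site} (hp : p ∉ idx X) :
    twoAlpha (patO X p) = 0 := by
  have hall : ∀ j : Fin 6, p + octV j ∉ X := by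
    intro j hj; apply hp
    have := mem_idx hj (octV_mem j); rwa [add_sub_cancel_right] at this
  have hpat : patO X p = fun _ => false := by
    funext j; simp [patO, hall j]
  rw [hpat]; decide

/-- The value of the tent at an octahedron centre, for every anchor. -/
theorem tent_centre (X : Finset Site) (p : Site) :
    tent X (centre p) = (twoAlpha (patO X p) : ℝ) / 2 := by
  rw [centre_eq, tent_hole]
  split_ifs with h
  · rfl
  · rw [twoAlpha_patO_eq_zero_of_not_mem_idx h]; simp

/-- **Up-tetrahedron cost**: `phiFcc g · |cell| ≤ 2·eTetUp / 24`. -/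
theorem cost_labelUp_le (X : Finset Site) (p : Site) {g : EuclideanSpace ℝ (Fin 3)} {b : ℝ}
    (hgb : ∀ x ∈ closedChamber (labelUp p).1 (labelUp p).2, tent X x = ⟪g, x⟫ + b) :
    phiFcc g * (volume (cellOf (labelUp p).1 (labelUp p).2)).toReal ≤ (2 * eTetUp X p : ℝ) / 24 := by
  have h : ∀ j : Fin 4, ⟪g, site (p + tetUpV j)⟫ + b = indR (patUp X p j) := by
    intro j; rw [← hgb _ (site_tetUpV_mem_closedChamber p j), tent_site_patUp]
  have hφ := phiFcc_grad_tetUp h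
  rw [eT4_patUp] at hφ
  have hvol : (volume (cellOf (labelUp p).1 (labelUp p).2)).toReal ≤ 1 / (6 * Real.sqrt 2) :=
    le_trans (ENNReal.toReal_mono ENNReal.ofReal_ne_top (volume_cellOf_labelUp_le p))
      (by rw [ENNReal.toReal_ofReal (by positivity)])
  have he : (0 : ℝ) ≤ eTetUp X p := by
    have : (0 : ℤ) ≤ eTetUp X p := Finset.sum_nonneg fun i _ => Finset.sum_nonneg fun j _ => by
      split_ifs <;> norm_num
    exact_mod_cast this
  rw [hφ]
  calc Real.sqrt 2 / 2 * (eTetUp X p : ℝ) * (volume (cellOf (labelUp p).1 (labelUp p).2)).toReal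
      ≤ Real.sqrt 2 / 2 * (eTetUp X p : ℝ) * (1 / (6 * Real.sqrt 2)) :=
        mul_le_mul_of_nonneg_left hvol (by positivity)
    _ = (2 * eTetUp X p : ℝ) / 24 := by
        have hs : (0 : ℝ) < Real.sqrt 2 := by positivity
        field_simp; ring

/-- **Down-tetrahedron cost**: `phiFcc g · |cell| ≤ 2·eTetDn / 24`. -/
theorem cost_labelDn_le (X : Finset Site) (p : Site) {g : EuclideanSpace ℝ (Fin 3)} {b : ℝ}
    (hgb : ∀ x ∈ closedChamber (labelDn p).1 (labelDn p).2, tent X x = ⟪g, x⟫ + b) :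
    phiFcc g * (volume (cellOf (labelDn p).1 (labelDn p).2)).toReal ≤ (2 * eTetDn X p : ℝ) / 24 := by
  have h : ∀ j : Fin 4, ⟪g, site (p + tetDnV j)⟫ + b = indR (patDn X p j) := by
    intro j; rw [← hgb _ (site_tetDnV_mem_closedChamber p j), tent_site_patDn]
  have hφ := phiFcc_grad_tetDn h
  rw [eT4_patDn] at hφ
  have hvol : (volume (cellOf (labelDn p).1 (labelDn p).2)).toReal ≤ 1 / (6 * Real.sqrt 2) :=
    le_trans (ENNReal.toReal_mono ENNReal.ofReal_ne_top (volume_cellOf_labelDn_le p))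
      (by rw [ENNReal.toReal_ofReal (by positivity)])
  have he : (0 : ℝ) ≤ eTetDn X p := by
    have : (0 : ℤ) ≤ eTetDn X p := Finset.sum_nonneg fun i _ => Finset.sum_nonneg fun j _ => by
      split_ifs <;> norm_num
    exact_mod_cast this
  rw [hφ]
  calc Real.sqrt 2 / 2 * (eTetDn X p : ℝ) * (volume (cellOf (labelDn p).1 (labelDn p).2)).toReal
      ≤ Real.sqrt 2 / 2 * (eTetDn X p : ℝ) * (1 / (6 * Real.sqrt 2)) :=
        mul_le_mul_of_nonneg_left hvol (by positivity)
    _ = (2 * eTetDn X p : ℝ) / 24 := by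
        have hs : (0 : ℝ) < Real.sqrt 2 := by positivity
        field_simp; ring

/-- The corner cost of `…TentTables` in the `cw'` form delivered by `phiFcc_grad_corner`. -/
theorem corner_eq_phiZ_cw' (bb : Fin 6 → Bool) (s : Fin 3 → Bool) :
    corner bb (octIdx 0 (s 0)) (octIdx 1 (s 1)) (octIdx 2 (s 2)) =
      phiZ (cw' (bb (octIdx 0 (s 0))) (twoAlpha bb)) (cw' (bb (octIdx 1 (s 1))) (twoAlpha bb))
        (cw' (bb (octIdx 2 (s 2))) (twoAlpha bb)) := by
  have habs : ∀ k : Fin 6, |cw bb k| = |cw' (bb k) (twoAlpha bb)| := by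
    intro k
    simp only [cw, cw', abs_mul]
    split_ifs <;> simp
  rw [corner, ← phiZ_abs, habs, habs, habs, phiZ_abs]

/-- `phiZ ≥ 0`. -/
theorem phiZ_nonneg (a b c : ℤ) : 0 ≤ phiZ a b c := by
  unfold phiZ; positivity

/-- **Corner cost**: `phiFcc g · |cell| ≤ corner / 24`. -/
theorem cost_labelCorner_le (X : Finset Site) (p : Site) (s : Fin 3 → Bool) {g : EuclideanSpace ℝ (Fin 3)}
    {b : ℝ} (hgb : ∀ x ∈ closedChamber (labelCorner p s).1 (labelCorner p s).2, tent X x = ⟪g, x⟫ + b) :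
    phiFcc g * (volume (cellOf (labelCorner p s).1 (labelCorner p s).2)).toReal ≤
      (corner (patO X p) (octIdx 0 (s 0)) (octIdx 1 (s 1)) (octIdx 2 (s 2)) : ℝ) / 24 := by
  have h0 : ⟪g, centre p⟫ + b = (twoAlpha (patO X p) : ℝ) / 2 := by
    rw [← hgb _ (centre_mem_closedChamber p s), tent_centre]
  have h : ∀ a : Fin 3, ⟪g, site (p + octV (octIdx a (s a)))⟫ + b = indR (patO X p (octIdx a (s a))) := by
    intro a; rw [← hgb _ (site_octV_mem_closedChamber p s a), tent_site_patO]
  have hφ := phiFcc_grad_corner (v := fun a => patO X p (octIdx a (s a))) s h0 h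
  rw [corner_eq_phiZ_cw']
  have hvol : (volume (cellOf (labelCorner p s).1 (labelCorner p s).2)).toReal ≤ 1 / (12 * Real.sqrt 2) :=
    le_trans (ENNReal.toReal_mono ENNReal.ofReal_ne_top (volume_cellOf_labelCorner_le p s))
      (by rw [ENNReal.toReal_ofReal (by positivity)])
  set z : ℤ := phiZ (cw' (patO X p (octIdx 0 (s 0))) (twoAlpha (patO X p)))
    (cw' (patO X p (octIdx 1 (s 1))) (twoAlpha (patO X p)))
    (cw' (patO X p (octIdx 2 (s 2))) (twoAlpha (patO X p))) with hz
  have hz0 : (0 : ℝ) ≤ z := by exact_mod_cast phiZ_nonneg _ _ _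
  rw [hφ]
  calc Real.sqrt 2 / 2 * (z : ℝ) * (volume (cellOf (labelCorner p s).1 (labelCorner p s).2)).toReal
      ≤ Real.sqrt 2 / 2 * (z : ℝ) * (1 / (12 * Real.sqrt 2)) :=
        mul_le_mul_of_nonneg_left hvol (by positivity)
    _ = (z : ℝ) / 24 := by
        have hs : (0 : ℝ) < Real.sqrt 2 := by positivity
        field_simp; ring

/-- The eight corner costs of an octahedron pattern add up to `octCost24`. -/
theorem sum_corner_eq_octCost24 (bb : Fin 6 → Bool) :
    ∑ s : Fin 3 → Bool, corner bb (octIdx 0 (s 0)) (octIdx 1 (s 1)) (octIdx 2 (s 2)) = octCost24 bb := by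
  -- enumerate the eight sign vectors
  have huniv : (Finset.univ : Finset (Fin 3 → Bool)) =
      {![false, false, false], ![false, false, true], ![false, true, false], ![false, true, true],
       ![true, false, false], ![true, false, true], ![true, true, false], ![true, true, true]} := by
    decide
  rw [huniv, Finset.sum_insert (by decide), Finset.sum_insert (by decide), Finset.sum_insert (by decide),
    Finset.sum_insert (by decide), Finset.sum_insert (by decide), Finset.sum_insert (by decide),
    Finset.sum_insert (by decide), Finset.sum_singleton]
  have e : ∀ b₀ b₁ b₂ : Bool, corner bb (octIdx 0 ((![b₀, b₁, b₂] : Fin 3 → Bool) 0))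
      (octIdx 1 ((![b₀, b₁, b₂] : Fin 3 → Bool) 1)) (octIdx 2 ((![b₀, b₁, b₂] : Fin 3 → Bool) 2)) =
      corner bb (if b₀ then 1 else 0) (if b₁ then 2 else 3) (if b₂ then 4 else 5) := by
    intro b₀ b₁ b₂; rfl
  simp only [e, octCost24]
  simp
  ring

/-! ## Distances inside a cell -/

/-- **Two points of one closed chamber are within `√2`** (their `D₃` coordinates differ by at most `1`). -/
theorem dist_le_sqrt2_of_mem_closedChamber {k : Fin 3 → ℤ} {m : Fin 4 → ℤ} {x y : EuclideanSpace ℝ (Fin 3)}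
    (hx : x ∈ closedChamber k m) (hy : y ∈ closedChamber k m) : dist x y ≤ Real.sqrt 2 := by
  rw [EuclideanSpace.dist_eq]
  apply Real.sqrt_le_sqrt
  have hs : (0 : ℝ) < Real.sqrt 2 := by positivity
  have hs2 : Real.sqrt 2 ^ 2 = 2 := Real.sq_sqrt (by norm_num)
  have hc : ∀ i : Fin 3, (x i - y i) ^ 2 ≤ 1 / 2 := by
    intro i
    have h1 := hx.1 i; have h2 := hy.1 i
    have hd : (Real.sqrt 2 * (x i - y i)) ^ 2 ≤ 1 := by
      rw [sq_le_one_iff_abs_le_one, abs_le]; constructor <;> nlinarith [h1.1, h1.2, h2.1, h2.2]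
    nlinarith [hd, hs2]
  simp only [Real.dist_eq, sq_abs]
  rw [Fin.sum_univ_three]
  linarith [hc 0, hc 1, hc 2]

/-- **An octahedron vertex and a point of one of its corners are within `√2`.** -/
theorem dist_octV_le_sqrt2 (p : Site) (s : Fin 3 → Bool) {y : EuclideanSpace ℝ (Fin 3)}
    (hy : y ∈ closedChamber (labelCorner p s).1 (labelCorner p s).2) (i : Fin 6) :
    dist (site (p + octV i)) y ≤ Real.sqrt 2 := by
  obtain ⟨a₀, bo, rfl⟩ := exists_octIdx_eq i
  obtain ⟨t₀, t₁, t₂, h₀, h₁, h₂, hsum, hy'⟩ := exists_barycentric_labelCorner p s hy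
  have hs : (0 : ℝ) < Real.sqrt 2 := by positivity
  have hs2 : Real.sqrt 2 ^ 2 = 2 := Real.sq_sqrt (by norm_num)
  rw [EuclideanSpace.dist_eq]
  apply Real.sqrt_le_sqrt
  -- coordinates of the difference
  set t : Fin 3 → ℝ := ![t₀, t₁, t₂] with ht
  have htn : ∀ a, 0 ≤ t a := by intro a; fin_cases a <;> simp [ht, h₀, h₁, h₂]
  have hts : t 0 + t 1 + t 2 ≤ 1 := by simp [ht]; exact hsum
  have hσ : ∀ bo' : Bool, sgnR bo' ^ 2 = 1 := by intro bo'; cases bo' <;> simp [sgnR]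
  have hcoord : ∀ l : Fin 3, (site (p + octV (octIdx a₀ bo)) l - y l) ^ 2 =
      ((sgnR bo * (if l = a₀ then 1 else 0) - t l * sgnR (s l)) / Real.sqrt 2) ^ 2 := by
    intro l
    rw [hy', site_octV, site_octV, site_octV, site_octV]
    simp only [add_sub_cancel_left, smul_smul, PiLp.add_apply, PiLp.smul_apply,
      smul_eq_mul, PiLp.single_apply]
    fin_cases l <;> fin_cases a₀ <;> simp [ht] <;> field_simp
  simp only [Real.dist_eq, sq_abs, hcoord, div_pow, hs2]
  rw [Fin.sum_univ_three]
  -- each coordinate: `(σ₀ δ − t σ)² ≤ …`; sum ≤ 4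
  have hb : ∀ l : Fin 3, (sgnR bo * (if l = a₀ then (1:ℝ) else 0) - t l * sgnR (s l)) ^ 2 ≤
      (if l = a₀ then 1 + 3 * t l else t l) := by
    intro l
    have htl := htn l
    have ht1 : t l ≤ 1 := by
      have := hts; fin_cases l <;> simp [ht] at * <;> linarith [h₀, h₁, h₂]
    split_ifs with hl
    · have h1 : -(1 + t l) ≤ sgnR bo * 1 - t l * sgnR (s l) := by
        cases bo <;> rcases Bool.eq_false_or_eq_true (s l) with h | h <;> simp [sgnR, h] <;> linarith
      have h2 : sgnR bo * 1 - t l * sgnR (s l) ≤ 1 + t l := by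
        cases bo <;> rcases Bool.eq_false_or_eq_true (s l) with h | h <;> simp [sgnR, h] <;> linarith
      have := sq_le_sq' h1 h2
      nlinarith
    · simp only [mul_zero, zero_sub, even_two, Even.neg_pow, mul_pow, hσ, mul_one]
      nlinarith
  have e0 := hb 0; have e1 := hb 1; have e2 := hb 2
  fin_cases a₀ <;> simp at e0 e1 e2 ⊢ <;> nlinarith [hts, htn 0, htn 1, htn 2]

end Summit.Ventures.Crystal3D.TentCertificate

end
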